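import Summits.RiemannHypothesis.RiemannHypothesis.Theorems.WeilGroundStateGroundStatesConvergeToXiEvenWitness
import Literature.NumberTheory.LFunctions.WeilGroundState
import HarnessLib

/-!
# Stub `stub_evenWitness_tight` of the line `Sketch`
(crux `WeilGroundState.GroundStatesConvergeToXi`, item stmt-RiemannHypothesis-1527, rev L8)

**Even normal form of crux witnesses, with transfer of `b`-tightness (RH-free).**  A crux-shaped
witness — windows `a_k → ∞`, ground states `u_k` (`IsWeilGroundState (a k) (u k)`), scalars
`c_k` with `c_k · weilMellin u_k → ξ` locally uniformly on the open strip `{0 < Re s < 1}` —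
yields an EVEN crux-shaped witness `(a'_k, v_k, c'_k)` with `c'_k ≠ 0` such that, for every
exponent `b : ℝ`, a uniform bound `∫ ‖c_k u_k(t)‖ e^{b|t|} dt ≤ M` (all `k`) transfers to
`∫ ‖c'_k v_k(t)‖ e^{b|t|} dt ≤ M` (all `k`).

Construction (the one of `exists_even_cruxWitness`, `…EvenWitness`): a tail `k ↦ k + K₀` of
the normalised even parts `v_k = u_kᵉ/‖u_kᵉ‖₂`, `u_kᵉ(t) = (u_k(t) + u_k(-t))/2`, with
`c'_k = c_k ‖u_kᵉ‖₂`.  The reflected witness converges (`û(1 - ·) = (u(-·))^`,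
`weilMellin_comp_neg`, and `ξ(1 - s) = ξ(s)`), hence so do the even parts; at `s = 1/2`,
`ξ(1/2) ≠ 0` forces `u_kᵉ ≠ 0` in `L²` and `c_k ≠ 0` for `k ≥ K₀`; `u_kᵉ/‖u_kᵉ‖₂` is a ground
state (`isWeilGroundState_evenPart`).  Tightness bookkeeping: pointwise
`c'_k v_k = c_k (u_k + u_k(-·))/2`, so
`‖c'_k v_k(t)‖ e^{b|t|} ≤ (‖c_k u_k(t)‖ e^{b|t|} + ‖c_k u_k(-t)‖ e^{b|-t|})/2` and, integrating
(`integral_neg_eq_self` for the reflected term), `∫ ‖c'_k v_k‖ e^{b|t|} ≤ ∫ ‖c_k u_k‖ e^{b|t|} ≤ M`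
— the same `M` bounds the tail.

Mathlib + proved tree material only; no named fact; no definitions; standard axioms.
-/

set_option linter.dupNamespace false

noncomputable section

open MeasureTheory Complex Filter Set
open scoped Real Topology ComplexConjugate

namespace Summit.RiemannHypothesis.RiemannHypothesis.Theorems.GroundStatesConvergeToXi

open Literature.NumberTheory.LFunctions

/-! ### Exponential moments of the even part -/

/-- A scalar multiple `c · u` of a ground state has all exponential moments
`∫ ‖c u(t)‖ e^{A|t|} dt` finite (`u` is integrable on the compact window and vanishes a.e. off
it; `IsWeilGroundState.integrable_mul_continuous`). [folklore] -/
theorem evenWitnessTight_integrable_norm_mul_exp {a : ℝ} {u : ℝ → ℂ}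
    (hu : IsWeilGroundState a u) (c : ℂ) (A : ℝ) :
    Integrable (fun t : ℝ ↦ ‖c * u t‖ * Real.exp (A * |t|)) := by
  -- adapted from `momentsOfStrip_expMoment_groundState` (…StubMomentsOfStrip)
  have h := (hu.integrable_mul_continuous
    (w := fun t : ℝ ↦ c * ((Real.exp (A * |t|) : ℝ) : ℂ)) (by fun_prop)).norm
  refine h.congr (ae_of_all _ fun t ↦ ?_)
  simp only [norm_mul, Complex.norm_real, Real.norm_eq_abs, Real.abs_exp]
  ring

/-- **The even part does not increase exponential moments**: for a ground state `u`, a scalar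
`c` and an exponent `b`,
`∫ ‖c (u(t) + u(-t))/2‖ e^{b|t|} dt ≤ ∫ ‖c u(t)‖ e^{b|t|} dt`
(triangle inequality, and `∫ f(-t) dt = ∫ f(t) dt` with `|-t| = |t|` for the reflected term).
[folklore] -/
theorem evenWitnessTight_integral_evenPart_le {a : ℝ} {u : ℝ → ℂ}
    (hu : IsWeilGroundState a u) (c : ℂ) (b : ℝ) :
    ∫ t, ‖c * ((u t + u (-t)) / 2)‖ * Real.exp (b * |t|) ≤
      ∫ t, ‖c * u t‖ * Real.exp (b * |t|) := by
  have hf := evenWitnessTight_integrable_norm_mul_exp hu c b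
  have hf' : Integrable (fun t : ℝ ↦ ‖c * u (-t)‖ * Real.exp (b * |t|)) :=
    evenWitnessTight_integrable_norm_mul_exp (isWeilGroundState_comp_neg hu) c b
  have hrefl : ∫ t, ‖c * u (-t)‖ * Real.exp (b * |t|) = ∫ t, ‖c * u t‖ * Real.exp (b * |t|) := by
    have h := integral_neg_eq_self (fun t : ℝ ↦ ‖c * u t‖ * Real.exp (b * |t|)) volume
    simpa only [abs_neg] using h
  have hpt : ∀ t : ℝ, ‖c * ((u t + u (-t)) / 2)‖ * Real.exp (b * |t|) ≤
      (‖c * u t‖ * Real.exp (b * |t|) + ‖c * u (-t)‖ * Real.exp (b * |t|)) / 2 := fun t ↦ by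
    have e : c * ((u t + u (-t)) / 2) = (c * u t + c * u (-t)) / 2 := by ring
    rw [e, norm_div, Complex.norm_two]
    have h := norm_add_le (c * u t) (c * u (-t))
    have hexp := (Real.exp_pos (b * |t|)).le
    calc ‖c * u t + c * u (-t)‖ / 2 * Real.exp (b * |t|)
        ≤ (‖c * u t‖ + ‖c * u (-t)‖) / 2 * Real.exp (b * |t|) := by gcongr
      _ = _ := by ring
  calc ∫ t, ‖c * ((u t + u (-t)) / 2)‖ * Real.exp (b * |t|)
      ≤ ∫ t, (‖c * u t‖ * Real.exp (b * |t|) + ‖c * u (-t)‖ * Real.exp (b * |t|)) / 2 :=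
        integral_mono_of_nonneg (Eventually.of_forall fun t ↦ by positivity)
          ((hf.add hf').div_const 2) (Eventually.of_forall hpt)
    _ = ((∫ t, ‖c * u t‖ * Real.exp (b * |t|)) + ∫ t, ‖c * u (-t)‖ * Real.exp (b * |t|)) / 2 := by
        rw [integral_div, integral_add hf hf']
    _ = ∫ t, ‖c * u t‖ * Real.exp (b * |t|) := by
        rw [hrefl]
        ring

/-! ### The stub -/

/-- **Stub `stub_evenWitness_tight` — crux witnesses may be taken even, with transfer of
`b`-tightness (RH-free).**  Let `a_k → ∞`, `u_k` ground states at the windows `a_k` and `c_k`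
scalars with `c_k · weilMellin u_k → ξ` locally uniformly on the open critical strip.  Then there
is a witness of the same shape with `c'_k ≠ 0` and EVEN ground states `v_k(-t) = v_k(t)` — a tail
of the normalised even parts `v_k = u_kᵉ/‖u_kᵉ‖₂`, `c'_k = c_k ‖u_kᵉ‖₂` — such that for every
`b : ℝ` a uniform bound `∫ ‖c_k u_k‖ e^{b|t|} ≤ M` implies `∫ ‖c'_k v_k‖ e^{b|t|} ≤ M`
(`c'_k v_k = c_k (u_k + u_k(-·))/2` pointwise and `e^{b|t|}` is even). [folklore] -/
theorem stub_evenWitness_tight :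
    ∀ (a : ℕ → ℝ) (u : ℕ → ℝ → ℂ) (c : ℕ → ℂ), Tendsto a atTop atTop →
      (∀ k, IsWeilGroundState (a k) (u k)) →
      TendstoLocallyUniformlyOn (fun k s => c k * weilMellin (u k) s) riemannXi atTop
        {s : ℂ | 0 < s.re ∧ s.re < 1} →
      ∃ a' : ℕ → ℝ, ∃ v : ℕ → ℝ → ℂ, ∃ c' : ℕ → ℂ, Tendsto a' atTop atTop ∧ (∀ k, c' k ≠ 0) ∧
        (∀ k, IsWeilGroundState (a' k) (v k)) ∧ (∀ k t, v k (-t) = v k t) ∧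
        (∀ b : ℝ, (∃ M : ℝ, ∀ k, ∫ t, ‖c k * u k t‖ * Real.exp (b * |t|) ≤ M) →
          ∃ M : ℝ, ∀ k, ∫ t, ‖c' k * v k t‖ * Real.exp (b * |t|) ≤ M) ∧
        TendstoLocallyUniformlyOn (fun k s => c' k * weilMellin (v k) s) riemannXi atTop
          {s : ℂ | 0 < s.re ∧ s.re < 1} := by
  intro a u c ha hu hlim
  -- adapted from `exists_even_cruxWitness` (…EvenWitness), plus the tightness bookkeeping
  have hS : IsOpen {s : ℂ | 0 < s.re ∧ s.re < 1} :=
    (isOpen_lt continuous_const Complex.continuous_re).inter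
      (isOpen_lt Complex.continuous_re continuous_const)
  -- the reflected witness converges as well
  have hrefl : TendstoLocallyUniformlyOn (fun k s ↦ c k * weilMellin (fun t ↦ u k (-t)) s)
      riemannXi atTop {s : ℂ | 0 < s.re ∧ s.re < 1} := by
    have hmaps : MapsTo (fun s : ℂ ↦ 1 - s) {s : ℂ | 0 < s.re ∧ s.re < 1}
        {s : ℂ | 0 < s.re ∧ s.re < 1} := fun s hs ↦ by
      simp only [mem_setOf_eq, sub_re, one_re] at hs ⊢
      constructor <;> linarith [hs.1, hs.2]
    have h := hlim.comp (fun s : ℂ ↦ 1 - s) hmaps (continuous_const.sub continuous_id).continuousOn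
    have hξ : riemannXi ∘ (fun s : ℂ ↦ 1 - s) = riemannXi := funext fun s ↦ riemannXi_one_sub s
    rw [hξ] at h
    refine h.congr fun k s _ ↦ ?_
    simp only [Function.comp_apply, weilMellin_comp_neg]
  -- hence so do the even parts
  have hMe : ∀ k s, weilMellin (fun t ↦ (u k t + u k (-t)) / 2) s =
      (weilMellin (u k) s + weilMellin (fun t ↦ u k (-t)) s) / 2 := fun k s ↦ by
    rw [weilMellin_evenPart (hu k), weilMellin_comp_neg]
  have heven : TendstoLocallyUniformlyOn
      (fun k s ↦ c k * weilMellin (fun t ↦ (u k t + u k (-t)) / 2) s) riemannXi atTop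
      {s : ℂ | 0 < s.re ∧ s.re < 1} := by
    rw [tendstoLocallyUniformlyOn_iff_forall_isCompact hS] at hlim hrefl ⊢
    intro K hKS hK
    have h1 := Metric.tendstoUniformlyOn_iff.1 (hlim K hKS hK)
    have h2 := Metric.tendstoUniformlyOn_iff.1 (hrefl K hKS hK)
    rw [Metric.tendstoUniformlyOn_iff]
    intro ε hε
    filter_upwards [h1 ε hε, h2 ε hε] with k hk1 hk2 s hs
    have e1 : riemannXi s - c k * weilMellin (fun t ↦ (u k t + u k (-t)) / 2) s =
        ((riemannXi s - c k * weilMellin (u k) s) +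
          (riemannXi s - c k * weilMellin (fun t ↦ u k (-t)) s)) / 2 := by
      rw [hMe]
      ring
    rw [dist_eq_norm, e1, norm_div, Complex.norm_two]
    have h3 := norm_add_le (riemannXi s - c k * weilMellin (u k) s)
      (riemannXi s - c k * weilMellin (fun t ↦ u k (-t)) s)
    have h4 := hk1 s hs
    have h5 := hk2 s hs
    rw [dist_eq_norm] at h4 h5
    linarith
  -- at `s = 1/2` the limit `ξ(1/2) ≠ 0`: eventually the even parts (and the `c_k`) are non-zero
  have hhalf : (1 / 2 : ℂ) ∈ {s : ℂ | 0 < s.re ∧ s.re < 1} := by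
    simp only [mem_setOf_eq]
    norm_num
  have hev : ∀ᶠ k in atTop, c k * weilMellin (fun t ↦ (u k t + u k (-t)) / 2) (1 / 2) ≠ 0 :=
    (heven.tendsto_at hhalf).eventually_ne riemannXi_one_half_ne_zero
  obtain ⟨K₀, hK₀⟩ := eventually_atTop.1 hev
  have hNpos : ∀ k, 0 < ∫ t, ‖(u (k + K₀) t + u (k + K₀) (-t)) / 2‖ ^ 2 := by
    intro k
    have hne := hK₀ (k + K₀) (Nat.le_add_left _ _)
    have hnn : 0 ≤ ∫ t, ‖(u (k + K₀) t + u (k + K₀) (-t)) / 2‖ ^ 2 :=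
      integral_nonneg fun _ ↦ by positivity
    rcases hnn.eq_or_lt with h0 | hpos
    · exfalso
      apply hne
      rw [weilMellin_eq_zero_of_integral_norm_sq_eq_zero (memLp_evenPart (hu _).1) h0.symm,
        mul_zero]
    · exact hpos
  have hcne : ∀ k, c (k + K₀) ≠ 0 := fun k h ↦
    hK₀ (k + K₀) (Nat.le_add_left _ _) (by rw [h, zero_mul])
  have hRne : ∀ k, (Real.sqrt (∫ s, ‖(u (k + K₀) s + u (k + K₀) (-s)) / 2‖ ^ 2) : ℂ) ≠ 0 :=
    fun k ↦ Complex.ofReal_ne_zero.2 (Real.sqrt_ne_zero'.2 (hNpos k))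
  -- recombination `c'_k v_k = c_k u_kᵉ`
  have hrec : ∀ k t, c (k + K₀) * (Real.sqrt (∫ s, ‖(u (k + K₀) s + u (k + K₀) (-s)) / 2‖ ^ 2) : ℂ)
      * ((((Real.sqrt (∫ s, ‖(u (k + K₀) s + u (k + K₀) (-s)) / 2‖ ^ 2))⁻¹ : ℝ) : ℂ) *
        ((u (k + K₀) t + u (k + K₀) (-t)) / 2)) =
      c (k + K₀) * ((u (k + K₀) t + u (k + K₀) (-t)) / 2) := fun k t ↦ by
    rw [Complex.ofReal_inv, ← mul_assoc, mul_assoc (c (k + K₀)), mul_inv_cancel₀ (hRne k),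
      mul_one]
  -- the even witness: a tail of the normalised even parts
  refine ⟨fun k ↦ a (k + K₀),
    fun k t ↦ (((Real.sqrt (∫ s, ‖(u (k + K₀) s + u (k + K₀) (-s)) / 2‖ ^ 2))⁻¹ : ℝ) : ℂ) *
      ((u (k + K₀) t + u (k + K₀) (-t)) / 2),
    fun k ↦ c (k + K₀) * (Real.sqrt (∫ s, ‖(u (k + K₀) s + u (k + K₀) (-s)) / 2‖ ^ 2) : ℂ),
    ha.comp (tendsto_add_atTop_nat K₀), fun k ↦ mul_ne_zero (hcne k) (hRne k),
    fun k ↦ isWeilGroundState_evenPart (hu _) (hNpos k), fun k t ↦ ?_, ?_, ?_⟩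
  · simp only [neg_neg]
    ring
  · -- tightness transfers with the same bound `M`
    rintro b ⟨M, hM⟩
    refine ⟨M, fun k ↦ ?_⟩
    simp_rw [hrec]
    exact (evenWitnessTight_integral_evenPart_le (hu (k + K₀)) (c (k + K₀)) b).trans
      (hM (k + K₀))
  · have hshift : TendstoLocallyUniformlyOn
        (fun k s ↦ c (k + K₀) * weilMellin (fun t ↦ (u (k + K₀) t + u (k + K₀) (-t)) / 2) s)
        riemannXi atTop {s : ℂ | 0 < s.re ∧ s.re < 1} := by
      rw [tendstoLocallyUniformlyOn_iff_forall_isCompact hS] at heven ⊢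
      intro K hKS hK
      have h := Metric.tendstoUniformlyOn_iff.1 (heven K hKS hK)
      rw [Metric.tendstoUniformlyOn_iff]
      intro ε hε
      exact (tendsto_add_atTop_nat K₀).eventually (h ε hε)
    refine hshift.congr fun k s _ ↦ ?_
    rw [weilMellin_const_mul, Complex.ofReal_inv, ← mul_assoc, mul_assoc (c (k + K₀)),
      mul_inv_cancel₀ (hRne k), mul_one]
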